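import Literature.Probability.LatticeModels.DoubleCurrentsProofs
import Literature.Probability.Percolation.ConstrainedClusters
import HarnessLib

/-!
# ADS15 eqs. (3.2)–(3.3): the double-current connection probability inside the box

Trunk G02 (T-STATMECH), topic `Probability/LatticeModels`; namespace `Literature.StatMech`.
First finite-volume step of the proof of ADS15 Thm. 3.1 (whose finite-volume reading is the named
fact `Literature.Probability.LatticeModels.ads_exitProb_tendsto_zero_of_lroTildeSq` of `DoubleCurrents.lean`):

* M. Aizenman, H. Duminil-Copin, V. Sidoravicius, *Random currents and continuity of Ising
  model's spontaneous magnetization*, Comm. Math. Phys. **334** (2015) 719–742, §3.1,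
  eqs. (3.2)–(3.3) (arXiv:1311.1937v3 numbering; bib key
  `AizenmanDuminilCopinSidoraviciusCMP2015`, "ADS15"): by the switching lemma,
  `P⁰_{Λ_L,β} ⊗ P⁺_{Λ_L,β}[x ↔ y in Λ_L] = ∑_{∂n₁={x,y}, ∂n₂={x,y}} w w / ∑_{∂n₁=∅, ∂n₂=∅} w w`
  (3.2), and by the representations (2.7)–(2.8)
  `= ⟨σ_xσ_y⟩⁰_{Λ_L,β} ⟨σ_xσ_y⟩⁺_{Λ_L,β} ≤ ⟨σ_xσ_y⟩⁰_{Λ_L,β}` (3.3).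

Here "`x ↔ y in Λ_L`" is the tree's event `openConnVia (withinGraph (zdGraph d) ↑(box d L)) x y`
(`ConstrainedClusters.lean`: `x` and `y` are joined by open lattice bonds with both endpoints in
`Λ_L`; ADS15: connection in `𝒫₂(Λ_L)`), and the law is the ghost-free double current
`adsDoubleCurrentLaw d L β` of `DoubleCurrents.lean`. Both displays are proved
(`adsDoubleCurrentLaw_openConnVia_box_eq`, `adsDoubleCurrentLaw_openConnVia_box_le`), from
`Current.tsum_switching` (`CurrentSwitching.lean`) with `A = B = ∅`, the random-current
representations in the box (`DoubleCurrentsProofs.lean`) and GKS I. They are the finite-volume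
input of ADS15 (3.4)–(3.5) and Thm. 3.1 (forthcoming `DoubleCurrentsPercolation.lean`, which
derives the named fact `Literature.Probability.LatticeModels.ads_exitProb_tendsto_zero_of_lroTildeSq` of
`DoubleCurrents.lean` from the uniqueness of the infinite cluster).

## Mathlib status

No random currents in Mathlib. Anchors: `SimpleGraph.Reachable.map`, `SimpleGraph.Walk`
induction, `tsum_mul_tsum_of_summable_norm`, `Sym2.map.injective`; tree: `openConnVia`,
`withinGraph`, `mem_openClusterIn_iff`, `openGraph_inter_edgeSet` (`ConstrainedClusters.lean`).
-/

noncomputable section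

open MeasureTheory Filter Topology Finset Literature.Probability.LatticeModels Literature.Probability.Percolation
open scoped symmDiff

namespace Literature.Probability.LatticeModels

variable (d : ℕ)

/-! ### The event "`x ↔ y in Λ_L`" -/

/-- The bonds with both endpoints in `Λ` are the edges of the step graph `withinGraph G Λ`. [folklore] -/
theorem coe_edgesIn_eq_edgeSet_withinGraph {V : Type*} [DecidableEq V] (G : SimpleGraph V)
    [G.LocallyFinite] (Λ : Finset V) :
    (↑(edgesIn G Λ) : Set (Sym2 V)) = (withinGraph G ↑Λ).edgeSet := by
  ext e
  induction e using Sym2.ind with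
  | _ u v =>
    rw [Finset.mem_coe, mem_edgesIn_iff, mem_edgeSet_withinGraph, SimpleGraph.mem_edgeSet]
    constructor
    · rintro ⟨h, hin⟩
      exact ⟨h, hin u (Sym2.mem_mk_left u v), hin v (Sym2.mem_mk_right u v)⟩
    · rintro ⟨h, hu, hv⟩
      refine ⟨h, fun w hw => ?_⟩
      rcases Sym2.mem_iff.1 hw with rfl | rfl
      · exact hu
      · exact hv

/-- **"`x ↔ y` in `Λ_L`"** (ADS15 (3.2): `x` and `y` are connected by bonds of `𝒫₂(Λ_L)` carrying
current) is the tree's `openConnVia (withinGraph (zdGraph d) ↑(box d L)) x y`: `x` and `y` are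
joined by open nearest-neighbour bonds with both endpoints in `Λ_L`. [cite: AizenmanDuminilCopinSidoraviciusCMP2015, §3.1, eq. (3.2)] -/
theorem mem_openConnVia_withinGraph_box_iff {L : ℕ} {x y : Site d} {ω : BondConfig (Site d)} :
    ω ∈ openConnVia (withinGraph (zdGraph d) ↑(box d L)) x y ↔
      (openGraph (ω ∩ ↑(edgesIn (zdGraph d) (box d L)))).Reachable x y := by
  rw [coe_edgesIn_eq_edgeSet_withinGraph, openGraph_inter_edgeSet]
  exact mem_openClusterIn_iff

/-- The trace of a pair (free current, plus current) in `Λ_L`, restricted to the free bonds, lifts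
to the bonds inside `Λ_L`: connection through free bonds in `↥Λ_{L+1}` gives connection in `Λ_L`
after lifting. [folklore] -/
theorem reachable_liftBonds_inter_edgesIn {L : ℕ} (n : Current (plusBoxGraph d L))
    {a b : BoxVertex d L} (h : (openGraph (n.tracedIn (freeBoxGraph d L))).Reachable a b) :
    (openGraph (liftBonds d L n.traced ∩ ↑(edgesIn (zdGraph d) (box d L)))).Reachable
      (a : Site d) b := by
  let f : openGraph (n.tracedIn (freeBoxGraph d L)) →g
      openGraph (liftBonds d L n.traced ∩ ↑(edgesIn (zdGraph d) (box d L))) :=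
    { toFun := fun v => (v : Site d)
      map_rel' := by
        intro u v huv
        rw [openGraph_adj] at huv ⊢
        obtain ⟨⟨h₀, htr⟩, hne⟩ := huv
        have hadj := (SimpleGraph.mem_edgeSet _).1 h₀
        refine ⟨⟨⟨s(u, v), htr, by simp⟩, ?_⟩, fun h => hne (Subtype.ext h)⟩
        rw [Finset.mem_coe, mem_edgesIn_iff]
        refine ⟨(SimpleGraph.mem_edgeSet _).2 hadj.1, ?_⟩
        intro w hw
        rcases Sym2.mem_iff.1 hw with rfl | rfl
        · exact hadj.2.1
        · exact hadj.2.2 }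
  exact h.map f

/-- Conversely, an open walk in `Λ_L` of lifted trace bonds pulls back to a path of free bonds in
`↥Λ_{L+1}` (all its vertices lie in `Λ_L ⊆ Λ_{L+1}`, all its bonds have both endpoints in `Λ_L`). [folklore] -/
theorem reachable_tracedIn_of_walk_liftBonds {L : ℕ} (n : Current (plusBoxGraph d L))
    {y : Site d} (hy : y ∈ box d (L + 1)) {u : Site d} (hu : u ∈ box d (L + 1))
    (p : (openGraph (liftBonds d L n.traced ∩ ↑(edgesIn (zdGraph d) (box d L)))).Walk u y) :
    (openGraph (n.tracedIn (freeBoxGraph d L))).Reachable (⟨u, hu⟩ : BoxVertex d L) ⟨y, hy⟩ := by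
  induction p with
  | nil => exact SimpleGraph.Reachable.refl _
  | @cons u v w huv p ih =>
    rw [openGraph_adj] at huv
    obtain ⟨⟨hlift, hin⟩, hne⟩ := huv
    rw [Finset.mem_coe, mem_edgesIn_iff] at hin
    have hvL : v ∈ box d L := hin.2 v (Sym2.mem_mk_right u v)
    have huL : u ∈ box d L := hin.2 u (Sym2.mem_mk_left u v)
    have hv : v ∈ box d (L + 1) := box_subset_box_succ d L hvL
    refine SimpleGraph.Reachable.trans (SimpleGraph.Adj.reachable ?_) (ih hy hv)
    rw [openGraph_adj]
    refine ⟨⟨?_, ?_⟩, fun h => hne (congrArg Subtype.val h)⟩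
    · rw [SimpleGraph.mem_edgeSet]
      exact ⟨(SimpleGraph.mem_edgeSet _).1 hin.1, huL, hvL⟩
    · obtain ⟨e', he', he'eq⟩ := hlift
      have : e' = s((⟨u, hu⟩ : BoxVertex d L), ⟨v, hv⟩) := by
        apply Sym2.map.injective Subtype.val_injective
        rw [he'eq, Sym2.map_mk]
      rw [← this]
      exact he'

/-- Hence an open path in `Λ_L` of lifted trace bonds gives `x ↔ y` through free bonds in
`↥Λ_{L+1}`. [folklore] -/
theorem reachable_tracedIn_of_reachable_liftBonds {L : ℕ} (n : Current (plusBoxGraph d L))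
    {x y : Site d} (hx : x ∈ box d (L + 1)) (hy : y ∈ box d (L + 1))
    (h : (openGraph (liftBonds d L n.traced ∩ ↑(edgesIn (zdGraph d) (box d L)))).Reachable x y) :
    (openGraph (n.tracedIn (freeBoxGraph d L))).Reachable (⟨x, hx⟩ : BoxVertex d L) ⟨y, hy⟩ := by
  obtain ⟨p⟩ := h
  exact reachable_tracedIn_of_walk_liftBonds d n hy hx p

/-- **The lifted trace of the double current connects `x` to `y` in `Λ_L` iff `x ↔ y` through free
bonds of the total current** (`Current.connIn (freeBoxGraph d L)`), for `x, y ∈ Λ_{L+1}`. [cite: AizenmanDuminilCopinSidoraviciusCMP2015, §3.1, eq. (3.2)] -/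
theorem liftBonds_mem_openConnVia_withinGraph_box_iff {L : ℕ} (n₁ : Current (freeBoxGraph d L))
    (n₂ : Current (plusBoxGraph d L)) {x y : Site d} (hx : x ∈ box d (L + 1))
    (hy : y ∈ box d (L + 1)) :
    liftBonds d L (n₁.traced ∪ n₂.traced) ∈ openConnVia (withinGraph (zdGraph d) ↑(box d L)) x y ↔
      Current.extend n₁ + n₂ ∈ Current.connIn (freeBoxGraph d L) (⟨x, hx⟩ : BoxVertex d L) ⟨y, hy⟩ := by
  have hle := freeBoxGraph_le_plusBoxGraph d L
  have htr : (Current.extend (G := plusBoxGraph d L) n₁ + n₂).traced = n₁.traced ∪ n₂.traced := by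
    rw [Current.traced_add, Current.traced_extend hle]
  rw [mem_openConnVia_withinGraph_box_iff, Current.mem_connIn_iff, ← htr]
  exact ⟨reachable_tracedIn_of_reachable_liftBonds d _ hx hy,
    reachable_liftBonds_inter_edgesIn d _⟩

/-! ### ADS15 (3.2)–(3.3) -/

/-- **ADS15 eq. (3.2) with (2.7)–(2.8), proved**: for the nearest-neighbour model, `β ≥ 0` and
`x, y ∈ Λ_L`,
`ℙ_{Λ_L,β}[x ↔ y in Λ_L] = ⟨σ_xσ_y⟩⁰_{Λ_L,β} ⟨σ_xσ_y⟩⁺_{Λ_L,β}`: by the switching lemma with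
`A = B = ∅` the pairs `(∂n₁ = ∅, ∂n₂ ∩ Λ_L = ∅)` connecting `x` to `y` through free bonds are
traded for the pairs `(∂n₁ = {x,y}, ∂n₂ ∩ Λ_L = {x,y})` (on which the connection is automatic),
whose total weight is `Z⁰(xy) Z⁺(xy)`. [cite: AizenmanDuminilCopinSidoraviciusCMP2015, §3.1, eqs. (3.2)–(3.3)] -/
theorem adsDoubleCurrentLaw_openConnVia_box_eq (L : ℕ) {β : ℝ} (hβ : 0 ≤ β) {x y : Site d}
    (hx : x ∈ box d L) (hy : y ∈ box d L) :
    (adsDoubleCurrentLaw d L β).real (openConnVia (withinGraph (zdGraph d) ↑(box d L)) x y) =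
      isingTwoPoint (zdGraph d) (box d L) β 0 .free x y *
        isingTwoPoint (zdGraph d) (box d L) β 0 .plus x y := by
  classical
  haveI := isProbabilityMeasure_adsDoubleCurrentLaw d L hβ
  -- the degenerate case `x = y`
  by_cases hxy : x = y
  · subst hxy
    rw [isingTwoPoint_self, isingTwoPoint_self, mul_one]
    have : openConnVia (withinGraph (zdGraph d) ↑(box d L)) x x = Set.univ :=
      Set.eq_univ_of_forall fun ω => SimpleGraph.Reachable.refl x
    rw [this, probReal_univ]
  -- notation
  have hle : freeBoxGraph d L ≤ plusBoxGraph d L := freeBoxGraph_le_plusBoxGraph d L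
  have hx1 : x ∈ box d (L + 1) := box_subset_box_succ d L hx
  have hy1 : y ∈ box d (L + 1) := box_subset_box_succ d L hy
  set x' : BoxVertex d L := ⟨x, hx1⟩ with hx'
  set y' : BoxVertex d L := ⟨y, hy1⟩ with hy'
  have hxy' : x' ≠ y' := fun h => hxy (congrArg Subtype.val h)
  have hx'Λ : x' ∈ (boxCore d L) := (mem_boxCore d).2 hx
  have hy'Λ : y' ∈ (boxCore d L) := (mem_boxCore d).2 hy
  set D : Finset (BoxVertex d L) := {x'} ∆ {y'} with hD
  have hDpair : D = {x', y'} := Current.symmDiff_singleton_eq_pair hxy'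
  have hDΛ : D ⊆ (boxCore d L) := by
    rw [hDpair]
    intro v hv
    rcases Finset.mem_insert.1 hv with rfl | hv
    · exact hx'Λ
    · rw [Finset.mem_singleton.1 hv]; exact hy'Λ
  have hDmap : D.map (boxEmb d L) = {x, y} := by
    rw [hDpair, Finset.map_insert, Finset.map_singleton]; rfl
  -- the weight families
  set a : Finset (BoxVertex d L) → Current (plusBoxGraph d L) → ℝ := fun A n =>
    if Current.IsSupp (freeBoxGraph d L) n ∧ n.sources = A then n.weight β else 0 with ha
  set b : Finset (BoxVertex d L) → Current (plusBoxGraph d L) → ℝ := fun B n =>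
    if n.sources ∩ (boxCore d L) = B then n.weight β else 0 with hb
  have hw := summable_currentWeight_holds (plusBoxGraph d L) β
  have has : ∀ A, Summable fun n => ‖a A n‖ := fun A =>
    Summable.of_nonneg_of_le (fun n => norm_nonneg _) (fun n => by
      rw [Real.norm_eq_abs]; simp only [ha]; split_ifs
      · rw [abs_of_nonneg (Current.weight_nonneg hβ n)]
      · rw [abs_zero]; exact Current.weight_nonneg hβ n) hw
  have hbs : ∀ B, Summable fun n => ‖b B n‖ := fun B =>
    Summable.of_nonneg_of_le (fun n => norm_nonneg _) (fun n => by
      rw [Real.norm_eq_abs]; simp only [hb]; split_ifs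
      · rw [abs_of_nonneg (Current.weight_nonneg hβ n)]
      · rw [abs_zero]; exact Current.weight_nonneg hβ n) hw
  set Z₀ : Finset (BoxVertex d L) → ℝ := fun A => plusCurrentSum (freeBoxGraph d L) (boxCore d L) β A with hZ₀
  set Z : Finset (BoxVertex d L) → ℝ := fun B => plusCurrentSum (plusBoxGraph d L) (boxCore d L) β B with hZ
  have hZ₀a : ∀ A, Z₀ A = ∑' n, a A n := fun A => plusCurrentSum_free_eq_tsum d L β A
  have hprod : ∀ A B, Z₀ A * Z B =
      ∑' p : Current (plusBoxGraph d L) × Current (plusBoxGraph d L), a A p.1 * b B p.2 := by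
    intro A B
    rw [hZ₀a]
    exact tsum_mul_tsum_of_summable_norm (has A) (hbs B)
  -- the connection indicator and the switching lemma with `A = B = ∅`
  set conn : Current (plusBoxGraph d L) → ℝ := (Current.connIn (freeBoxGraph d L) x' y').indicator 1 with hconn
  have hsw := Current.tsum_switching (G := plusBoxGraph d L) (freeBoxGraph d L) β (boxCore d L) ∅ ∅
    x' y' (fun _ => (1 : ℝ)) ⟨1, fun _ => by norm_num⟩
  have hA' : (∅ : Finset (BoxVertex d L)) ∆ ({x'} ∆ {y'}) = D := by
    rw [← hD, ← Finset.bot_eq_empty, bot_symmDiff]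
  have hB' : (∅ : Finset (BoxVertex d L)) ∆ (({x'} ∆ {y'}) ∩ (boxCore d L)) = D := by
    rw [← hD, Finset.inter_eq_left.2 hDΛ, ← Finset.bot_eq_empty, bot_symmDiff]
  simp only [one_mul] at hsw
  rw [hA', hB'] at hsw
  -- on `{∂n₁ = D}` the indicator is `1`
  have hsw_r : ∑' p : Current (plusBoxGraph d L) × Current (plusBoxGraph d L), a D p.1 * b D p.2 * conn (p.1 + p.2) =
      ∑' p : Current (plusBoxGraph d L) × Current (plusBoxGraph d L), a D p.1 * b D p.2 := by
    refine tsum_congr fun p => ?_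
    by_cases hp : Current.IsSupp (freeBoxGraph d L) p.1 ∧ p.1.sources = D
    · have : conn (p.1 + p.2) = 1 := by
        simp only [hconn, Set.indicator_of_mem (Current.add_mem_connIn_of_sources_eq (freeBoxGraph d L) hp.1 hp.2 p.2),
          Pi.one_apply]
      rw [this, mul_one]
    · simp only [ha, if_neg hp, zero_mul]
  have h32 : ∑' p : Current (plusBoxGraph d L) × Current (plusBoxGraph d L), a ∅ p.1 * b ∅ p.2 * conn (p.1 + p.2) = Z₀ D * Z D := by
    rw [hprod, ← hsw_r]
    exact hsw
  -- the event under the double current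
  have hN := adsPairNorm_pos d L hβ
  have hreal : (adsDoubleCurrentLaw d L β).real (openConnVia (withinGraph (zdGraph d) ↑(box d L)) x y) =
      (∑' p : Current (plusBoxGraph d L) × Current (plusBoxGraph d L),
        a ∅ p.1 * (b ∅ p.2 * conn (p.1 + p.2))) / adsPairNorm d L β := by
    rw [adsDoubleCurrentLaw_real_apply d L hβ hN]
    have h1 : ∀ q : Current (freeBoxGraph d L) × Current (plusBoxGraph d L),
        adsPairWeight d L β q / adsPairNorm d L β *
          (if liftBonds d L (q.1.traced ∪ q.2.traced) ∈ openConnVia (withinGraph (zdGraph d) ↑(box d L)) x y then (1 : ℝ) else 0) =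
        (adsPairNorm d L β)⁻¹ * (adsPairWeight d L β q * conn (Current.extend q.1 + q.2)) := by
      intro q
      have hiff := liftBonds_mem_openConnVia_withinGraph_box_iff d q.1 q.2 hx1 hy1
      have hind : (if liftBonds d L (q.1.traced ∪ q.2.traced) ∈ openConnVia (withinGraph (zdGraph d) ↑(box d L)) x y then (1 : ℝ) else 0)
          = conn (Current.extend q.1 + q.2) := by
        simp only [hconn, Set.indicator_apply, Pi.one_apply]
        by_cases h : liftBonds d L (q.1.traced ∪ q.2.traced) ∈ openConnVia (withinGraph (zdGraph d) ↑(box d L)) x y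
        · rw [if_pos h, if_pos (hiff.1 h)]
        · rw [if_neg h, if_neg fun h' => h (hiff.2 h')]
      rw [hind]; ring
    simp_rw [h1]
    rw [tsum_mul_left]
    have h2 : ∑' q : Current (freeBoxGraph d L) × Current (plusBoxGraph d L),
        adsPairWeight d L β q * conn (Current.extend q.1 + q.2) =
        ∑' p : Current (plusBoxGraph d L) × Current (plusBoxGraph d L),
          a ∅ p.1 * (b ∅ p.2 * conn (p.1 + p.2)) :=
      tsum_adsPairWeight_mul_eq d L β (fun p => conn (p.1 + p.2))
    rw [h2, inv_mul_eq_div]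
  -- conclusion
  have hnorm : adsPairNorm d L β = Z₀ ∅ * Z ∅ := adsPairNorm_eq_mul d L hβ
  have hZ₀pos : 0 < Z₀ ∅ := plusCurrentSum_empty_pos (freeBoxGraph d L) (edgesTouching_freeBoxGraph d L) β
  have hZpos : 0 < Z ∅ := plusCurrentSum_empty_pos (plusBoxGraph d L) (edgesTouching_plusBoxGraph d L) β
  have hfree : isingTwoPoint (zdGraph d) (box d L) β 0 .free x y = Z₀ D / Z₀ ∅ := by
    rw [isingTwoPoint_eq_isingCorr _ _ _ _ _ hxy, ← hDmap]
    exact isingCorr_free_box_eq d L β hDΛ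
  have hplus : isingTwoPoint (zdGraph d) (box d L) β 0 .plus x y = Z D / Z ∅ := by
    rw [isingTwoPoint_eq_isingCorr _ _ _ _ _ hxy, ← hDmap]
    exact isingCorr_plus_box_eq d L β hDΛ
  have h32' : ∑' p : Current (plusBoxGraph d L) × Current (plusBoxGraph d L),
      a ∅ p.1 * (b ∅ p.2 * conn (p.1 + p.2)) = Z₀ D * Z D := by
    simpa only [mul_assoc] using h32
  rw [hreal, h32', hnorm, hfree, hplus]
  field_simp

/-- **ADS15 eq. (3.3), proved**: `ℙ_{Λ_L,β}[x ↔ y in Λ_L] ≤ ⟨σ_xσ_y⟩⁰_{Λ_L,β}` for `β ≥ 0`,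
`x, y ∈ Λ_L` (from (3.2), `0 ≤ ⟨σ_xσ_y⟩⁰` by GKS I and `⟨σ_xσ_y⟩⁺ ≤ 1`). [cite: AizenmanDuminilCopinSidoraviciusCMP2015, §3.1, eq. (3.3)] -/
theorem adsDoubleCurrentLaw_openConnVia_box_le (L : ℕ) {β : ℝ} (hβ : 0 ≤ β) {x y : Site d}
    (hx : x ∈ box d L) (hy : y ∈ box d L) :
    (adsDoubleCurrentLaw d L β).real (openConnVia (withinGraph (zdGraph d) ↑(box d L)) x y) ≤
      isingTwoPoint (zdGraph d) (box d L) β 0 .free x y := by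
  rw [adsDoubleCurrentLaw_openConnVia_box_eq d L hβ hx hy]
  have h0 : 0 ≤ isingTwoPoint (zdGraph d) (box d L) β 0 .free x y := by
    by_cases hxy : x = y
    · subst hxy; rw [isingTwoPoint_self]; exact zero_le_one
    · rw [isingTwoPoint_eq_isingCorr _ _ _ _ _ hxy]
      refine Literature.Probability.LatticeModels.GKSInequalities.gks_one_holds (zdGraph d) hβ le_rfl (Or.inl rfl) ?_
      intro v hv
      rcases Finset.mem_insert.1 hv with rfl | hv
      · exact hx
      · rw [Finset.mem_singleton.1 hv]; exact hy
  have h1 : isingTwoPoint (zdGraph d) (box d L) β 0 .plus x y ≤ 1 :=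
    (le_abs_self _).trans (abs_isingTwoPoint_le_one _ _ _ _ _ _ _)
  calc isingTwoPoint (zdGraph d) (box d L) β 0 .free x y *
        isingTwoPoint (zdGraph d) (box d L) β 0 .plus x y
      ≤ isingTwoPoint (zdGraph d) (box d L) β 0 .free x y * 1 :=
        mul_le_mul_of_nonneg_left h1 h0
    _ = _ := mul_one _

end Literature.Probability.LatticeModels
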